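import Summits.CriticalPhenomena.PercolationContinuityZ3.Theorems.Transplant.FKConnectivityAllQAntipodalMinorDefs
import Literature.Probability.LatticeModels.RandomClusterEdgeWeights
import HarnessLib

/-!
# Connectivity correlation inequalities for `φ_{w,q}`, every `q > 0` — the ANTIPODAL BRIDGE:
# coefficientwise (all cells `apPsiC`) ⇒ valuewise (covariances under `φ_{w,q}` for every `w ∈ [0,1]^E`)

Helper file (`--supports stmt-CriticalPhenomena-4575`), FK sub-lane `prim-bschramm-fk-3` (gen 9) of the post-continuity programme;
builds on p205010 (kernel theorem, internal audit signed; external expert review pending).  No named facts, no sorries, no new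
definitions.

`…AntipodalMinorDefs.lean` (fk-2 gen 11) defines the antipodal covariance form with a contracted set,
`FK.apPsiC q S σ f g = ∑_{T ⊆ S} q^{k(T∪σ)+k((S\T)∪σ)} (f(T∪σ) - f((S\T)∪σ)) (g(T∪σ) - g((S\T)∪σ))`, and records (docstring, paper) that it
is twice the coefficient of the monomial `z^{2·1_σ + 1_S}` of `Z² Cov_{φ_{z,q}}(f,g)`.  This file proves the corresponding EXACT EXPANSION at the
level of the tree's edge-parameter random-cluster weights `rcWeightW w q ∅` (Grimmett 2006, (1.20)) in the 'bracket' variables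
`w_e², w_e(1-w_e), (1-w_e)²`:
* `FK.sum_pairs_eq_sum_cells` — the re-indexing of ordered pairs of configurations `(γ, γ')` by
  `σ = γ ∩ γ'` (open in both), `S = γ Δ γ'` (open in exactly one), `T = γ \ γ'`: a pure `Finset` identity, by induction on the edge set;
* `FK.rcWeightW_pair_eq_cell` — the weight of a pair factorises over the cell:
  `W(σ∪T)·W(σ∪(S\T)) = (∏_{σ} w²)(∏_{S} w(1-w))(∏_{rest} (1-w)²) · q^{apExpC S σ T}`;
* **`FK.two_mul_cov_eq_sum_cells`** — for all `f g`,
  `2·(Z·Z[fg] - Z[f]·Z[g]) = ∑_{σ} ∑_{S ⊆ σᶜ} (∏_{σ} w²)(∏_{S} w(1-w))(∏_{(σ∪S)ᶜ} (1-w)²) · apPsiC q S σ f̂ ĝ`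
  (`Z[h] = ∑_ω rcWeightW w q ∅ ω · h ω`, `f̂ γ = f ↑γ`);
* **`FK.cov_nonpos_of_apPsiC_nonpos`** / **`FK.cov_nonneg_of_apPsiC_nonneg`** — hence 'every cell `≤ 0` (`≥ 0`)' implies
  `Z·Z[fg] ≤ Z[f]·Z[g]` (`≥`) for EVERY edge-parameter vector `w ∈ [0,1]^{Sym2 V}` — the bridge from fk-2's coefficientwise theorems
  (`apPsiC_edge_nonpos_of_isTTSP`, …) and from exact cell certificates (fk-3 gen 9: all cells of the hub functional on `K₆`, `K₇`) to
  covariance inequalities under `φ_{w,q}` itself.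
[cite: Grimmett2006, §1.4 eq. (1.20) (p. 15); §3.8 (pp. 61–62)]
-/

noncomputable section

namespace Summit.CriticalPhenomena.PercolationContinuityZ3.Theorems

namespace FK

open Literature.Probability.LatticeModels Literature.Probability.Percolation
open Literature.Probability.Percolation.BHK2006 (weight)
open scoped Classical

/-! ## 1. Re-indexing ordered pairs of configurations by cells -/

section Cells

variable {α : Type*} {β : Type*} [DecidableEq α] [AddCommMonoid β]

/-- **Pairs = cells.**  For a finite set `U` and any `Φ`,
`∑_{γ, γ' ⊆ U} Φ γ γ' = ∑_{σ ⊆ U} ∑_{S ⊆ U \ σ} ∑_{T ⊆ S} Φ (σ ∪ T) (σ ∪ (S \ T))`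
(`σ = γ ∩ γ'`, `S = γ Δ γ'`, `T = γ \ γ'`).  Induction on `U`. [folklore] -/
theorem sum_pairs_eq_sum_cells (U : Finset α) (Φ : Finset α → Finset α → β) :
    ∑ γ ∈ U.powerset, ∑ γ' ∈ U.powerset, Φ γ γ' =
      ∑ σ ∈ U.powerset, ∑ S ∈ (U \ σ).powerset, ∑ T ∈ S.powerset, Φ (σ ∪ T) (σ ∪ (S \ T)) := by
  induction U using Finset.induction_on generalizing Φ with
  | empty => simp
  | insert a U ha ih =>
    -- left-hand side: split both configurations by the state of `a`
    have hL : ∑ γ ∈ (insert a U).powerset, ∑ γ' ∈ (insert a U).powerset, Φ γ γ' =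
        (∑ γ ∈ U.powerset, ∑ γ' ∈ U.powerset, Φ γ γ') +
        (∑ γ ∈ U.powerset, ∑ γ' ∈ U.powerset, Φ γ (insert a γ')) +
        ((∑ γ ∈ U.powerset, ∑ γ' ∈ U.powerset, Φ (insert a γ) γ') +
        (∑ γ ∈ U.powerset, ∑ γ' ∈ U.powerset, Φ (insert a γ) (insert a γ'))) := by
      rw [Finset.sum_powerset_insert ha]
      simp_rw [Finset.sum_powerset_insert ha]
      rw [Finset.sum_add_distrib, Finset.sum_add_distrib]
    -- right-hand side: split `σ` by the state of `a`
    have hR : ∑ σ ∈ (insert a U).powerset, ∑ S ∈ (insert a U \ σ).powerset, ∑ T ∈ S.powerset, Φ (σ ∪ T) (σ ∪ (S \ T)) =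
        (∑ σ ∈ U.powerset, ∑ S ∈ (insert a U \ σ).powerset, ∑ T ∈ S.powerset, Φ (σ ∪ T) (σ ∪ (S \ T))) +
        ∑ σ ∈ U.powerset, ∑ S ∈ (insert a U \ insert a σ).powerset, ∑ T ∈ S.powerset,
          Φ (insert a σ ∪ T) (insert a σ ∪ (S \ T)) := Finset.sum_powerset_insert ha _
    -- `a ∈ σ`: the cell of `Φ₁₁`
    have hR2 : ∑ σ ∈ U.powerset, ∑ S ∈ (insert a U \ insert a σ).powerset, ∑ T ∈ S.powerset,
          Φ (insert a σ ∪ T) (insert a σ ∪ (S \ T)) =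
        ∑ σ ∈ U.powerset, ∑ S ∈ (U \ σ).powerset, ∑ T ∈ S.powerset,
          Φ (insert a (σ ∪ T)) (insert a (σ ∪ (S \ T))) := by
      refine Finset.sum_congr rfl fun σ _ => ?_
      rw [Finset.insert_sdiff_insert, Finset.sdiff_insert_of_notMem ha]
      refine Finset.sum_congr rfl fun S _ => Finset.sum_congr rfl fun T _ => ?_
      rw [Finset.insert_union, Finset.insert_union]
    -- `a ∉ σ`: split `S` by the state of `a`, then `T`
    have hR1 : ∑ σ ∈ U.powerset, ∑ S ∈ (insert a U \ σ).powerset, ∑ T ∈ S.powerset, Φ (σ ∪ T) (σ ∪ (S \ T)) =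
        (∑ σ ∈ U.powerset, ∑ S ∈ (U \ σ).powerset, ∑ T ∈ S.powerset, Φ (σ ∪ T) (σ ∪ (S \ T))) +
        ((∑ σ ∈ U.powerset, ∑ S ∈ (U \ σ).powerset, ∑ T ∈ S.powerset, Φ (σ ∪ T) (insert a (σ ∪ (S \ T)))) +
         (∑ σ ∈ U.powerset, ∑ S ∈ (U \ σ).powerset, ∑ T ∈ S.powerset, Φ (insert a (σ ∪ T)) (σ ∪ (S \ T)))) := by
      rw [← Finset.sum_add_distrib, ← Finset.sum_add_distrib]
      refine Finset.sum_congr rfl fun σ hσ => ?_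
      have haσ : a ∉ σ := fun h => ha (Finset.mem_powerset.1 hσ h)
      have haUσ : a ∉ U \ σ := fun h => ha (Finset.sdiff_subset h)
      rw [Finset.insert_sdiff_of_notMem U haσ, Finset.sum_powerset_insert haUσ, ← Finset.sum_add_distrib,
        ← Finset.sum_add_distrib, ← Finset.sum_add_distrib]
      refine Finset.sum_congr rfl fun S hS => ?_
      have haS : a ∉ S := fun h => haUσ (Finset.mem_powerset.1 hS h)
      rw [Finset.sum_powerset_insert haS]
      congr 1
      congr 1
      · refine Finset.sum_congr rfl fun T hT => ?_
        have haT : a ∉ T := fun h => haS (Finset.mem_powerset.1 hT h)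
        rw [Finset.insert_sdiff_of_notMem S haT, Finset.union_insert]
      · refine Finset.sum_congr rfl fun T _ => ?_
        rw [Finset.insert_sdiff_insert, Finset.sdiff_insert_of_notMem haS, Finset.union_insert]
    rw [hL, hR, hR1, hR2, ih Φ, ih (fun γ γ' => Φ γ (insert a γ')), ih (fun γ γ' => Φ (insert a γ) γ'),
      ih (fun γ γ' => Φ (insert a γ) (insert a γ'))]
    abel

end Cells

/-! ## 2. The weight of a complementary pair factorises over its cell -/

variable {V : Type*} [Fintype V]

/-- Sums over bond configurations are sums over the `Finset` power set of all pairs. [folklore] -/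
theorem sum_bondConfig_eq_sum_powerset (F : BondConfig V → ℝ) :
    ∑ ω : BondConfig V, F ω = ∑ γ ∈ (Finset.univ : Finset (Sym2 V)).powerset, F ↑γ := by
  rw [Finset.powerset_univ]
  exact (Fintype.sum_equiv Fintype.finsetEquivSet (fun γ : Finset (Sym2 V) => F ↑γ) F fun _ => rfl).symm

/-- **Pair weight = cell weight × `q^{apExpC}`.**  For `S ⊆ σᶜ` and `T ⊆ S`, the product of the random-cluster weights
(Grimmett 2006, (1.20)) of the complementary pair `(σ ∪ T, σ ∪ (S \ T))` is
`(∏_{σ} w²)(∏_{S} w(1-w))(∏_{(σ ∪ S)ᶜ} (1-w)²) · q^{k(T∪σ)+k((S\T)∪σ)}`. [cite: Grimmett2006, §1.4 eq. (1.20) (p. 15)] -/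
theorem rcWeightW_pair_eq_cell (w : Sym2 V → unitInterval) (q : ℝ) {σ S T : Finset (Sym2 V)}
    (hS : S ⊆ Finset.univ \ σ) (hT : T ⊆ S) :
    rcWeightW w q ∅ (↑(σ ∪ T) : BondConfig V) * rcWeightW w q ∅ (↑(σ ∪ (S \ T)) : BondConfig V) =
      ((∏ e ∈ σ, (w e : ℝ) ^ 2) * (∏ e ∈ S, (w e : ℝ) * (1 - w e)) *
          ∏ e ∈ (Finset.univ \ σ) \ S, (1 - (w e : ℝ)) ^ 2) * q ^ apExpC S σ T := by
  -- the Bernoulli part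
  have hw : weight (fun e => (w e : ℝ)) (↑(σ ∪ T) : BondConfig V) *
      weight (fun e => (w e : ℝ)) (↑(σ ∪ (S \ T)) : BondConfig V) =
      (∏ e ∈ σ, (w e : ℝ) ^ 2) * (∏ e ∈ S, (w e : ℝ) * (1 - w e)) *
          ∏ e ∈ (Finset.univ \ σ) \ S, (1 - (w e : ℝ)) ^ 2 := by
    unfold weight
    beta_reduce
    rw [← Finset.prod_mul_distrib, ← Finset.prod_sdiff (Finset.subset_univ σ), ← Finset.prod_sdiff hS]
    rw [show (∏ e ∈ σ, (w e : ℝ) ^ 2) * (∏ e ∈ S, (w e : ℝ) * (1 - w e)) *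
          ∏ e ∈ (Finset.univ \ σ) \ S, (1 - (w e : ℝ)) ^ 2 =
        (∏ e ∈ (Finset.univ \ σ) \ S, (1 - (w e : ℝ)) ^ 2) * (∏ e ∈ S, (w e : ℝ) * (1 - w e)) *
          ∏ e ∈ σ, (w e : ℝ) ^ 2 from by ring]
    congr 1
    · congr 1
      · refine Finset.prod_congr rfl fun e he => ?_
        have heS : e ∉ S := (Finset.mem_sdiff.1 he).2
        have heσ : e ∉ σ := (Finset.mem_sdiff.1 (Finset.mem_sdiff.1 he).1).2
        have heT : e ∉ T := fun h => heS (hT h)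
        have m1 : e ∉ (↑(σ ∪ T) : BondConfig V) := by simp [heσ, heT]
        have m2 : e ∉ (↑(σ ∪ (S \ T)) : BondConfig V) := by simp [heσ, heS]
        rw [if_neg m1, if_neg m2]; ring
      · refine Finset.prod_congr rfl fun e he => ?_
        have heσ : e ∉ σ := (Finset.mem_sdiff.1 (hS he)).2
        by_cases heT : e ∈ T
        · have m1 : e ∈ (↑(σ ∪ T) : BondConfig V) := by simp [heT]
          have m2 : e ∉ (↑(σ ∪ (S \ T)) : BondConfig V) := by simp [heσ, heT]
          rw [if_pos m1, if_neg m2]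
        · have m1 : e ∉ (↑(σ ∪ T) : BondConfig V) := by simp [heσ, heT]
          have m2 : e ∈ (↑(σ ∪ (S \ T)) : BondConfig V) := by simp [he, heT]
          rw [if_neg m1, if_pos m2]; ring
    · refine Finset.prod_congr rfl fun e he => ?_
      have m1 : e ∈ (↑(σ ∪ T) : BondConfig V) := by simp [he]
      have m2 : e ∈ (↑(σ ∪ (S \ T)) : BondConfig V) := by simp [he]
      rw [if_pos m1, if_pos m2]; ring
  unfold rcWeightW apExpC
  rw [Finset.union_comm T σ, Finset.union_comm (S \ T) σ, pow_add, ← hw]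
  ring

/-! ## 3. The bridge -/

/-- **Antipodal bridge (exact expansion).**  For every edge-parameter vector `w`, every real `q` and all test functions `f, g`:
`2·(Z·Z[fg] - Z[f]·Z[g]) = ∑_{σ} ∑_{S ⊆ σᶜ} (∏_{σ} w²)(∏_{S} w(1-w))(∏_{(σ∪S)ᶜ} (1-w)²) · apPsiC q S σ f̂ ĝ`, where
`Z[h] = ∑_{γ} rcWeightW w q ∅ ↑γ · h ↑γ` (Grimmett 2006, (1.20)) and `f̂ γ = f ↑γ`: the coefficient of the cell `(σ, S)` in the
bracket variables is fk-2's antipodal form with contracted set `σ`. [cite: Grimmett2006, §1.4 eq. (1.20) (p. 15); §3.8 (pp. 61–62)] -/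
theorem two_mul_cov_eq_sum_cells (w : Sym2 V → unitInterval) (q : ℝ) (f g : BondConfig V → ℝ) :
    2 * ((∑ γ ∈ (Finset.univ : Finset (Sym2 V)).powerset, rcWeightW w q ∅ (↑γ : BondConfig V)) *
          (∑ γ ∈ (Finset.univ : Finset (Sym2 V)).powerset, rcWeightW w q ∅ (↑γ : BondConfig V) * (f ↑γ * g ↑γ)) -
        (∑ γ ∈ (Finset.univ : Finset (Sym2 V)).powerset, rcWeightW w q ∅ (↑γ : BondConfig V) * f ↑γ) *
          (∑ γ ∈ (Finset.univ : Finset (Sym2 V)).powerset, rcWeightW w q ∅ (↑γ : BondConfig V) * g ↑γ)) =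
      ∑ σ ∈ (Finset.univ : Finset (Sym2 V)).powerset, ∑ S ∈ (Finset.univ \ σ).powerset,
        ((∏ e ∈ σ, (w e : ℝ) ^ 2) * (∏ e ∈ S, (w e : ℝ) * (1 - w e)) *
            ∏ e ∈ (Finset.univ \ σ) \ S, (1 - (w e : ℝ)) ^ 2) *
          apPsiC q S σ (fun γ => f ↑γ) (fun γ => g ↑γ) := by
  set P : Finset (Finset (Sym2 V)) := (Finset.univ : Finset (Sym2 V)).powerset with hP
  set W : Finset (Sym2 V) → ℝ := fun γ => rcWeightW w q ∅ (↑γ : BondConfig V) with hW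
  -- step 1: the left-hand side as a double sum
  have h1 : 2 * ((∑ γ ∈ P, W γ) * (∑ γ ∈ P, W γ * (f ↑γ * g ↑γ)) -
        (∑ γ ∈ P, W γ * f ↑γ) * (∑ γ ∈ P, W γ * g ↑γ)) =
      ∑ γ ∈ P, ∑ γ' ∈ P, W γ * W γ' * ((f ↑γ - f ↑γ') * (g ↑γ - g ↑γ')) := by
    have inner : ∀ γ : Finset (Sym2 V), ∑ γ' ∈ P, W γ * W γ' * ((f ↑γ - f ↑γ') * (g ↑γ - g ↑γ')) =
        W γ * (f ↑γ * g ↑γ) * (∑ γ' ∈ P, W γ') - W γ * f ↑γ * (∑ γ' ∈ P, W γ' * g ↑γ') -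
          W γ * g ↑γ * (∑ γ' ∈ P, W γ' * f ↑γ') + W γ * (∑ γ' ∈ P, W γ' * (f ↑γ' * g ↑γ')) := by
      intro γ
      have e : ∀ γ' : Finset (Sym2 V), W γ * W γ' * ((f ↑γ - f ↑γ') * (g ↑γ - g ↑γ')) =
          W γ * (f ↑γ * g ↑γ) * W γ' - W γ * f ↑γ * (W γ' * g ↑γ') -
            W γ * g ↑γ * (W γ' * f ↑γ') + W γ * (W γ' * (f ↑γ' * g ↑γ')) := fun γ' => by ring
      simp_rw [e, Finset.sum_add_distrib, Finset.sum_sub_distrib, ← Finset.mul_sum]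
    rw [Finset.sum_congr rfl fun γ _ => inner γ, Finset.sum_add_distrib, Finset.sum_sub_distrib,
      Finset.sum_sub_distrib, ← Finset.sum_mul, ← Finset.sum_mul, ← Finset.sum_mul, ← Finset.sum_mul]
    ring
  have h2 := sum_pairs_eq_sum_cells (Finset.univ : Finset (Sym2 V))
    (fun γ γ' => W γ * W γ' * ((f ↑γ - f ↑γ') * (g ↑γ - g ↑γ')))
  rw [← hP] at h2
  rw [h1, h2]
  refine Finset.sum_congr rfl fun σ _ => ?_
  refine Finset.sum_congr rfl fun S hS => ?_
  have hSsub : S ⊆ Finset.univ \ σ := Finset.mem_powerset.1 hS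
  unfold apPsiC
  rw [Finset.mul_sum]
  refine Finset.sum_congr rfl fun T hT => ?_
  have hTsub : T ⊆ S := Finset.mem_powerset.1 hT
  have hpair := rcWeightW_pair_eq_cell w q hSsub hTsub
  simp only [hW]
  rw [Finset.union_comm T σ, Finset.union_comm (S \ T) σ, hpair]
  ring

/-- **Coefficientwise ⇒ valuewise (negative side).**  If every cell of `Z² Cov(f,g)` is `≤ 0` — `apPsiC q S σ f̂ ĝ ≤ 0` for all
`σ` and all `S ⊆ σᶜ` — then `Z·Z[fg] ≤ Z[f]·Z[g]` for EVERY edge-parameter vector `w ∈ [0,1]^{Sym2 V}` (sums over all bond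
configurations, weights `rcWeightW w q ∅`, Grimmett 2006 (1.20)); no sign condition on `q` is needed for this direction of the bridge.
[cite: Grimmett2006, §1.4 eq. (1.20) (p. 15); §3.8 (pp. 61–62)] -/
theorem cov_nonpos_of_apPsiC_nonpos (w : Sym2 V → unitInterval) (q : ℝ) (f g : BondConfig V → ℝ)
    (h : ∀ σ S : Finset (Sym2 V), S ⊆ Finset.univ \ σ → apPsiC q S σ (fun γ => f ↑γ) (fun γ => g ↑γ) ≤ 0) :
    (∑ ω : BondConfig V, rcWeightW w q ∅ ω) * (∑ ω : BondConfig V, rcWeightW w q ∅ ω * (f ω * g ω)) ≤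
      (∑ ω : BondConfig V, rcWeightW w q ∅ ω * f ω) * (∑ ω : BondConfig V, rcWeightW w q ∅ ω * g ω) := by
  rw [sum_bondConfig_eq_sum_powerset (fun ω => rcWeightW w q ∅ ω),
    sum_bondConfig_eq_sum_powerset (fun ω => rcWeightW w q ∅ ω * (f ω * g ω)),
    sum_bondConfig_eq_sum_powerset (fun ω => rcWeightW w q ∅ ω * f ω),
    sum_bondConfig_eq_sum_powerset (fun ω => rcWeightW w q ∅ ω * g ω)]
  have key := two_mul_cov_eq_sum_cells w q f g
  have hle : ∑ σ ∈ (Finset.univ : Finset (Sym2 V)).powerset, ∑ S ∈ (Finset.univ \ σ).powerset,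
      ((∏ e ∈ σ, (w e : ℝ) ^ 2) * (∏ e ∈ S, (w e : ℝ) * (1 - w e)) *
          ∏ e ∈ (Finset.univ \ σ) \ S, (1 - (w e : ℝ)) ^ 2) *
        apPsiC q S σ (fun γ => f ↑γ) (fun γ => g ↑γ) ≤ 0 := by
    refine Finset.sum_nonpos fun σ _ => Finset.sum_nonpos fun S hS => ?_
    refine mul_nonpos_of_nonneg_of_nonpos ?_ (h σ S (Finset.mem_powerset.1 hS))
    refine mul_nonneg (mul_nonneg (Finset.prod_nonneg fun e _ => sq_nonneg _)
      (Finset.prod_nonneg fun e _ => mul_nonneg (w e).2.1 (sub_nonneg.2 (w e).2.2))) (Finset.prod_nonneg fun e _ => sq_nonneg _)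
  linarith

/-- **Coefficientwise ⇒ valuewise (positive side).**  If every cell is `≥ 0` then `Z·Z[fg] ≥ Z[f]·Z[g]` for every `w ∈ [0,1]^{Sym2 V}`.
[cite: Grimmett2006, §1.4 eq. (1.20) (p. 15); §3.8 (pp. 61–62)] -/
theorem cov_nonneg_of_apPsiC_nonneg (w : Sym2 V → unitInterval) (q : ℝ) (f g : BondConfig V → ℝ)
    (h : ∀ σ S : Finset (Sym2 V), S ⊆ Finset.univ \ σ → 0 ≤ apPsiC q S σ (fun γ => f ↑γ) (fun γ => g ↑γ)) :
    (∑ ω : BondConfig V, rcWeightW w q ∅ ω * f ω) * (∑ ω : BondConfig V, rcWeightW w q ∅ ω * g ω) ≤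
      (∑ ω : BondConfig V, rcWeightW w q ∅ ω) * (∑ ω : BondConfig V, rcWeightW w q ∅ ω * (f ω * g ω)) := by
  rw [sum_bondConfig_eq_sum_powerset (fun ω => rcWeightW w q ∅ ω),
    sum_bondConfig_eq_sum_powerset (fun ω => rcWeightW w q ∅ ω * (f ω * g ω)),
    sum_bondConfig_eq_sum_powerset (fun ω => rcWeightW w q ∅ ω * f ω),
    sum_bondConfig_eq_sum_powerset (fun ω => rcWeightW w q ∅ ω * g ω)]
  have key := two_mul_cov_eq_sum_cells w q f g
  have hge : 0 ≤ ∑ σ ∈ (Finset.univ : Finset (Sym2 V)).powerset, ∑ S ∈ (Finset.univ \ σ).powerset,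
      ((∏ e ∈ σ, (w e : ℝ) ^ 2) * (∏ e ∈ S, (w e : ℝ) * (1 - w e)) *
          ∏ e ∈ (Finset.univ \ σ) \ S, (1 - (w e : ℝ)) ^ 2) *
        apPsiC q S σ (fun γ => f ↑γ) (fun γ => g ↑γ) := by
    refine Finset.sum_nonneg fun σ _ => Finset.sum_nonneg fun S hS => ?_
    refine mul_nonneg ?_ (h σ S (Finset.mem_powerset.1 hS))
    refine mul_nonneg (mul_nonneg (Finset.prod_nonneg fun e _ => sq_nonneg _)
      (Finset.prod_nonneg fun e _ => mul_nonneg (w e).2.1 (sub_nonneg.2 (w e).2.2))) (Finset.prod_nonneg fun e _ => sq_nonneg _)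
  linarith

end FK

end Summit.CriticalPhenomena.PercolationContinuityZ3.Theorems
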